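import Summits.CriticalPhenomena.PercolationContinuityZ3.Theorems.PercNearOneGluingNoHeavyLowerTailSunflowerMultiPetalHomeRouting
import HarnessLib
import HarnessLib.Audit

/-!
# `NoHeavyLowerTail` (crux stmt-CriticalPhenomena-4575), abstract sunflower cubic, `k` petals: the COMPLEMENT-DUAL structure `F.dual` (kernel ↔ bottom via `S ↦ Sᶜ`)
# and FLIP DUALITY `F.dual.ZKflip D = F.ZKflip Dᶜ` — Conjecture G at the flip set `D` for the dual is G at `Dᶜ` for `F`; `F.dual.ZK = F.ZKflip univ`

Support file (seat `prim-l12-p2` gen 32; `--supports stmt-CriticalPhenomena-4575`; companion of `…SunflowerMultiPetalHomeRouting` (p359567: `ZKflip`, `FlipPartitionLemmaK`)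
and `…SunflowerMultiPetalFlipSlot` (p368113: slot form of G)).  Everything here is PROVED (no `sorry`, no named fact, no new conjecture).
Memo: run/shared/lean/prim/prim-l12/prim-l12-p2/FINDING-g32.md §2.

* `swapTB k` — the involution of `Fin (k+2)` exchanging the top and bottom labels (petals fixed); `s6K_swapTB` — the kernel `s6K` is invariant (an ordered (top, bottom)
  pair becomes a (bottom, top) pair; distinctness is preserved).
* `MSunflower.dual F` — kernel = sets whose complement is a bottom set, petal `i` = sets whose complement is a bottom or petal-`i` set (the up-sets `{S : Sᶜ ∈ B ∪ C_i}`);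
  `lab_dual : F.dual.lab S = swapTB k (F.lab Sᶜ)`.
* **`ZKflip_dual : F.dual.ZKflip D = F.ZKflip Dᶜ`** (since `(X ∆ D)ᶜ = X ∆ Dᶜ`), `ZK_dual : F.dual.ZK = F.ZKflip univ`, `ZKflip_dual_compl`.  Use: censuses and proofs of G need only
  the flip sets with `|D| ≤ |α|/2` once both `F` and `F.dual` are treated (this is how the exhaustive 6-point census of G was organised, FINDING-g31 §3); every theorem about
  kernel-side objects has a bottom-side twin by duality (e.g. kernel demotion ↔ bottom extension).
-/

namespace Summit.CriticalPhenomena.PercolationContinuityZ3.Theorems.SunflowerPartition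

open Finset

/-! ## The top/bottom swap on labels -/

/-- Exchange the top and bottom labels of `Fin (k+2)`, fixing the petals. [this work] -/
def swapTB (k : ℕ) (v : Fin (k + 2)) : Fin (k + 2) :=
  if v = Fin.last (k + 1) then 0 else if v = 0 then Fin.last (k + 1) else v

/-- `swapTB v = top ↔ v = 0`. [this work] -/
theorem swapTB_eq_last_iff (k : ℕ) (v : Fin (k + 2)) : swapTB k v = Fin.last (k + 1) ↔ v = 0 := by
  unfold swapTB
  have hne : (0 : Fin (k + 2)) ≠ Fin.last (k + 1) := by
    intro h; have := congrArg Fin.val h; simp at this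
  split_ifs with h1 h2
  · exact ⟨fun h => absurd h hne, fun h => absurd (h ▸ h1 : (0 : Fin (k+2)) = Fin.last (k + 1)) hne⟩
  · exact ⟨fun _ => h2, fun _ => rfl⟩
  · exact ⟨fun h => absurd h h1, fun h => absurd h h2⟩

/-- `swapTB v = 0 ↔ v = top`. [this work] -/
theorem swapTB_eq_zero_iff (k : ℕ) (v : Fin (k + 2)) : swapTB k v = 0 ↔ v = Fin.last (k + 1) := by
  unfold swapTB
  have hne : (Fin.last (k + 1) : Fin (k + 2)) ≠ 0 := by
    intro h; have := congrArg Fin.val h; simp at this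
  split_ifs with h1 h2
  · exact ⟨fun _ => h1, fun _ => rfl⟩
  · exact ⟨fun h => absurd h hne, fun h => absurd h h1⟩
  · exact ⟨fun h => absurd h h2, fun h => absurd h h1⟩

/-- `swapTB` is injective (indeed an involution). [this work] -/
theorem swapTB_eq_swapTB_iff (k : ℕ) (v w : Fin (k + 2)) : swapTB k v = swapTB k w ↔ v = w := by
  constructor
  · intro h
    by_cases hv0 : v = 0
    · have : swapTB k w = Fin.last (k + 1) := by rw [← h]; exact (swapTB_eq_last_iff k v).2 hv0
      rw [hv0, ((swapTB_eq_last_iff k w).1 this)]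
    by_cases hvt : v = Fin.last (k + 1)
    · have : swapTB k w = 0 := by rw [← h]; exact (swapTB_eq_zero_iff k v).2 hvt
      rw [hvt, ((swapTB_eq_zero_iff k w).1 this)]
    · have hw0 : w ≠ 0 := fun hw => hv0 ((swapTB_eq_last_iff k v).1 (h ▸ (swapTB_eq_last_iff k w).2 hw))
      have hwt : w ≠ Fin.last (k + 1) := fun hw => hvt ((swapTB_eq_zero_iff k v).1 (h ▸ (swapTB_eq_zero_iff k w).2 hw))
      have ev : swapTB k v = v := by unfold swapTB; rw [if_neg hvt, if_neg hv0]
      have ew : swapTB k w = w := by unfold swapTB; rw [if_neg hwt, if_neg hw0]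
      rw [← ev, ← ew]; exact h
  · rintro rfl; rfl

/-- `Fin 5` core: `s6H`-style kernel is invariant under the top/bottom swap. [this work] -/
theorem s6K_three_swapTB : ∀ x y z : Fin 5, s6K 3 (swapTB 3 x) (swapTB 3 y) (swapTB 3 z) = s6K 3 x y z := by decide

/-- **`s6K` is invariant under exchanging top and bottom.** [this work] -/
theorem s6K_swapTB (k : ℕ) (x y z : Fin (k + 2)) : s6K k (swapTB k x) (swapTB k y) (swapTB k z) = s6K k x y z := by
  -- chart the three labels into `Fin 5`, swap there, and compare
  set c := chart3 k x y with hc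
  have e4 : (4 : Fin 5) = Fin.last (3 + 1) := rfl
  have ht : ∀ w, w = Fin.last (k + 1) ↔ c w = Fin.last (3 + 1) := fun w => by rw [← e4]; exact (chart3_eq_four_iff k x y w).symm
  have h0 : ∀ w, w = 0 ↔ c w = 0 := fun w => (chart3_eq_zero_iff k x y w).symm
  have hxy : x = y ↔ c x = c y := chart3_eq_iff k x y (fun h _ => absurd rfl h.1)
  have hyz : y = z ↔ c y = c z := chart3_eq_iff k x y (fun h _ => absurd rfl h.2)
  have hxz : x = z ↔ c x = c z := chart3_eq_iff k x y (fun h _ => absurd rfl h.1)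
  -- the swapped labels are charted by `swapTB 3 ∘ c`
  have st : ∀ w, swapTB k w = Fin.last (k + 1) ↔ swapTB 3 (c w) = Fin.last (3 + 1) := fun w => by
    rw [swapTB_eq_last_iff, swapTB_eq_last_iff]; exact h0 w
  have s0 : ∀ w, swapTB k w = 0 ↔ swapTB 3 (c w) = 0 := fun w => by
    rw [swapTB_eq_zero_iff, swapTB_eq_zero_iff]; exact ht w
  have sxy : swapTB k x = swapTB k y ↔ swapTB 3 (c x) = swapTB 3 (c y) := by
    rw [swapTB_eq_swapTB_iff, swapTB_eq_swapTB_iff]; exact hxy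
  have syz : swapTB k y = swapTB k z ↔ swapTB 3 (c y) = swapTB 3 (c z) := by
    rw [swapTB_eq_swapTB_iff, swapTB_eq_swapTB_iff]; exact hyz
  have sxz : swapTB k x = swapTB k z ↔ swapTB 3 (c x) = swapTB 3 (c z) := by
    rw [swapTB_eq_swapTB_iff, swapTB_eq_swapTB_iff]; exact hxz
  rw [s6K_congr (st x) (s0 x) (st y) (s0 y) (st z) (s0 z) sxy syz sxz,
    s6K_congr (ht x) (h0 x) (ht y) (h0 y) (ht z) (h0 z) hxy hyz hxz]
  exact s6K_three_swapTB _ _ _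

variable {α : Type*} [DecidableEq α] [Fintype α]

/-- `(X ∆ D)ᶜ = X ∆ Dᶜ`. [this work] -/
theorem compl_symmDiff_eq (X D : Finset α) : (symmDiff X D)ᶜ = symmDiff X Dᶜ := by
  ext x
  simp only [mem_compl, mem_symmDiff]
  tauto

namespace MSunflower

variable {k : ℕ} (F : MSunflower k α)

/-! ## The complement-dual structure -/

/-- **COMPLEMENT DUAL**: kernel = `{S : Sᶜ is a bottom set}`, petal up-set `i` = `{S : Sᶜ is a bottom or petal-i set}`. [this work] -/
def dual : MSunflower k α where
  V i := univ.filter fun S => Sᶜ ∉ F.A ∧ (Sᶜ ∈ F.V i ∨ ∀ j, Sᶜ ∉ F.V j)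
  A := univ.filter fun S => Sᶜ ∉ F.A ∧ ∀ j, Sᶜ ∉ F.V j
  upperV := by
    intro i S T hST hS
    obtain ⟨hSA, hSV⟩ := (mem_filter.1 hS).2
    have hTS : Tᶜ ⊆ Sᶜ := compl_subset_compl.2 hST
    refine mem_filter.2 ⟨mem_univ _, fun hTA => hSA (F.upperA hTS hTA), ?_⟩
    by_cases hTi : Tᶜ ∈ F.V i
    · exact Or.inl hTi
    · refine Or.inr fun j hTj => ?_
      have hSj : Sᶜ ∈ F.V j := F.upperV j hTS hTj
      have hij : j ≠ i := fun h => hTi (h ▸ hTj)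
      rcases hSV with hSi | hSw
      · exact hSA (F.inter_sub j i hij (mem_inter.2 ⟨hSj, hSi⟩))
      · exact hSw j hSj
  upperA := by
    intro S T hST hS
    obtain ⟨hSA, hSV⟩ := (mem_filter.1 hS).2
    have hTS : Tᶜ ⊆ Sᶜ := compl_subset_compl.2 hST
    exact mem_filter.2 ⟨mem_univ _, fun hTA => hSA (F.upperA hTS hTA), fun j hTj => hSV j (F.upperV j hTS hTj)⟩
  A_sub := by
    intro i S hS
    obtain ⟨hSA, hSV⟩ := (mem_filter.1 hS).2
    exact mem_filter.2 ⟨mem_univ _, hSA, Or.inr hSV⟩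
  inter_sub := by
    intro i j hij S hS
    rw [mem_inter, mem_filter, mem_filter] at hS
    obtain ⟨⟨_, hSA, hi⟩, ⟨_, _, hj⟩⟩ := hS
    refine mem_filter.2 ⟨mem_univ _, hSA, ?_⟩
    rcases hi with hi | hw
    · rcases hj with hj | hw
      · exact absurd (F.inter_sub i j hij (mem_inter.2 ⟨hi, hj⟩)) hSA
      · exact hw
    · exact hw

/-- Membership in the dual kernel: the complement is a bottom set. [this work] -/
theorem mem_dual_A {S : Finset α} : S ∈ F.dual.A ↔ F.lab Sᶜ = 0 := by
  rw [lab_eq_zero_iff]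
  show S ∈ univ.filter (fun S => Sᶜ ∉ F.A ∧ ∀ j, Sᶜ ∉ F.V j) ↔ _
  rw [mem_filter]; exact ⟨fun h => h.2, fun h => ⟨mem_univ _, h⟩⟩

/-- Membership in a dual petal up-set. [this work] -/
theorem mem_dual_V {i : Fin k} {S : Finset α} : S ∈ F.dual.V i ↔ Sᶜ ∉ F.A ∧ (Sᶜ ∈ F.V i ∨ ∀ j, Sᶜ ∉ F.V j) := by
  show S ∈ univ.filter (fun S => Sᶜ ∉ F.A ∧ (Sᶜ ∈ F.V i ∨ ∀ j, Sᶜ ∉ F.V j)) ↔ _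
  rw [mem_filter]; exact ⟨fun h => h.2, fun h => ⟨mem_univ _, h⟩⟩

/-- **The dual labels are the swapped labels of the complements**: `F.dual.lab S = swapTB k (F.lab Sᶜ)`. [this work] -/
theorem lab_dual (S : Finset α) : F.dual.lab S = swapTB k (F.lab Sᶜ) := by
  rcases F.lab_cases Sᶜ with hA | h0 | ⟨i, hA, hV, hl⟩
  · -- complement in the kernel: dual label is bottom
    have hlab : F.lab Sᶜ = Fin.last (k + 1) := (F.lab_eq_last_iff _).2 hA
    rw [hlab, show swapTB k (Fin.last (k + 1)) = 0 from (swapTB_eq_zero_iff k _).2 rfl]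
    refine (F.dual.lab_eq_zero_iff S).2 ⟨fun h => (F.mem_dual_A.1 h ▸ hlab |> fun e => ?_) , fun i h => (F.mem_dual_V.1 h).1 hA⟩
    have := congrArg Fin.val e; simp at this
  · -- complement is bottom: dual label is top
    rw [h0, show swapTB k 0 = Fin.last (k + 1) from (swapTB_eq_last_iff k _).2 rfl]
    exact (F.dual.lab_eq_last_iff S).2 (F.mem_dual_A.2 h0)
  · -- complement is a petal-`i` set
    rw [hl]
    have hsw : swapTB k (petalLab k i) = petalLab k i := by
      unfold swapTB; rw [if_neg (petalLab_ne_last k i), if_neg (petalLab_ne_zero k i)]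
    rw [hsw]
    refine F.dual.lab_eq_petalLab (fun h => ?_) (F.mem_dual_V.2 ⟨hA, Or.inl hV⟩)
    have h0 : F.lab Sᶜ = 0 := F.mem_dual_A.1 h
    rw [hl] at h0
    exact petalLab_ne_zero k i h0

/-! ## Flip duality -/

/-- **FLIP DUALITY**: `F.dual.ZKflip D = F.ZKflip Dᶜ`. [this work] -/
theorem ZKflip_dual (D : Finset α) : F.dual.ZKflip D = F.ZKflip Dᶜ := by
  unfold ZKflip
  refine sum_congr rfl fun q _ => ?_
  rw [lab_dual, lab_dual, lab_dual, compl_symmDiff_eq, compl_symmDiff_eq, compl_symmDiff_eq, s6K_swapTB]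

/-- Dually: `F.dual.ZKflip Dᶜ = F.ZKflip D`. [this work] -/
theorem ZKflip_dual_compl (D : Finset α) : F.dual.ZKflip Dᶜ = F.ZKflip D := by
  rw [ZKflip_dual, compl_compl]

/-- The plain functional of the dual is the fully flipped functional: `F.dual.ZK = F.ZKflip univ`. [this work] -/
theorem ZK_dual : F.dual.ZK = F.ZKflip univ := by
  rw [← F.dual.ZKflip_empty, ZKflip_dual, compl_empty]

/-- The fully flipped functional is the plain functional of the dual: `F.ZKflip univ = F.dual.ZK` read as `0 ≤ …` statements are equivalent. [this work] -/
theorem ZKflip_univ_nonneg_iff : 0 ≤ F.ZKflip univ ↔ 0 ≤ F.dual.ZK := by rw [ZK_dual]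

end MSunflower

/-- Under ★ₖ every FULLY flipped functional is nonnegative (★ₖ for the dual structure). [this work] -/
theorem ZKflip_univ_nonneg_of_partitionLemmaK (h : PartitionLemmaK) {β : Type} [DecidableEq β] [Fintype β] {k : ℕ} (F : MSunflower k β) :
    0 ≤ F.ZKflip univ := by
  rw [← F.ZK_dual]; exact h k β F.dual

end Summit.CriticalPhenomena.PercolationContinuityZ3.Theorems.SunflowerPartition
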